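import Summits.QuantumFields.YangMills.Theorems.BalabanUVNodesN09OneBondChartRead
import Literature.MathematicalPhysics.QuantumFieldTheory.Balaban1983to89.HaarExpChartChangeOfVariablesPiInverse
import HarnessLib

/-!
# BalabanUVNodes ∕ N09 — THE FORWARD JACOBIAN LAW OF THE ONE-BOND (0.4) FIBRE MAP ON A CHART WINDOW (Haar to Haar) — LOCAL EDITION at a loop-`α`-small environment

Cell `pub-ymgap` (YM-PLAN Track A), width seat `pub-ymgap-dag-n09-w4` g5 (FILE 6 = INTENT-5); count-neutral helper of K1⁹ `StabilityBRunRowsAtRecordR13SepCoPHV` =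
stmt-QuantumFields-27364 (`--supports`, `--as helper`).  [I] = [Balaban1987RG1].

WHY.  dag-n09-w6's private-coordinate road to the N09 inclusion `hreg` (`…N09HregOfPerBondChartsAtRecord`, `…N09PerBondChartsOfInjectivityWindows`,
`…N09CentralWindowAtRecord`) displays, per step and coarse bond `c`, ONE analytic input that is not bookkeeping: the FORWARD change-of-variables law of one-bond Haar
measure under the one-variable (0.4) map `g ↦ Ū(U[β(c) ↦ g])(c)` — `Haar⌊F(W) = F_*(J·Haar⌊W)` on a window `W` on which `F` is injective, with a density `J`.  This file
proves that law on a SMALL chart window around `U₀(β c)` for every environment `U₀` inside the loop `α`-guard at `c` (`α ≤ 1∕24`, `α < δ_N`, `157·α < L^{−(d−1)}`), by feeding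
the one-bond edition `…N09OneBondChartRead.exists_chartWindow_injOn_fibreMap` (window, injectivity, semiconjugacy `Ψ ∘ Θ = Θ ∘ φ`, `φ(O) ⊆ B(0,s_C)`) to this seat's g4
`HaarExpChartChangeOfVariables.haar_restrict_image_eq_map_withDensity_jacobian` ([Helgason2000] Ch. I Thm 1.14 + the Euclidean change of variables), and moving the
law from the identity to `U₀(β c)` ∕ `Ū(U₀)(c)` by right translations (Haar is right invariant).

WHAT IS PROVED (0 def, 0 sorry).  ★★★ `exists_forwardLaw_oneBond_at_one` — at the identity: an open `O ∋ 0` inside the chart ball with `φ = φ_{U₀,c}` differentiable on `O`,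
`Ψ(k) := Ū(U₀[β(c) ↦ k·U₀(β c)])(c)·Ū(U₀)(c)⁻¹` injective on `Θ(O)`, and `Haar⌊Ψ(Θ(O)) = Ψ_*(J·Haar⌊Θ(O))`, `J(k) = |det jac(φ(Λk))|·|det Dφ(Λk)| ∕ |det jac(Λk)|`
(`jacDensity` of `HaarExponentialChartDensity`); `restrict_image_mulRight_eq_map` (bookkeeping); ★★★ `exists_forwardLaw_oneBond` — in the consumer's variables:
`W := Θ(O)·U₀(β c) ∋ U₀(β c)`, `F(g) := Ū(U₀[β(c) ↦ g])(c)` injective on `W`, `Haar⌊F(W) = F_*(J_F·Haar⌊W)`, `J_F(g) = J(g·U₀(β c)⁻¹)` — the `hfwd` SHAPE of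
`…N09PerBondChartsOfInjectivityWindows.exists_perBondCharts_of_injectivityWindows` on a small window at ONE environment.

HONEST FRAMING.  LOCAL edition only: the window is an unspecified small neighbourhood of `U₀(β c)` (inverse function theorem), NOT dag-n09-w6's central `α`-window
`Ωα c U`, and the density is not shown non-vanishing off the centre nor jointly measurable in `U` — those are the GLOBAL edition (this seat's located INTENT-6).  Classical
change of variables BY NAME on the tree's typed (0.4) objects; nothing of Bałaban's estimates asserted; `hreg` NOT discharged; N09 NOT discharged; conjunct 1 (Lemma 4) ∕
FLAG №7 untouched; K0⁷ ∕ K1⁹ ∕ K3⁸ NOT closed; counts unmoved; one finite four-torus programme at fixed `ε = L^{−K}` — R4 closes the conditional rung `BalabanLadder.UV`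
only; NOT ℝ⁴ ∕ infinite volume ∕ OS; the Yang–Mills mass gap (Clay) is NOT proved by any of this.
-/

noncomputable section

open scoped Matrix.Norms.L2Operator Topology ContDiff ENNReal
open Filter Set Function MeasureTheory

namespace Summit.QuantumFields.YangMills.BalabanUVNodes.N09OneBondForwardLaw

open Literature.MathematicalPhysics.QuantumFieldTheory.Balaban1983to89
open Literature.MathematicalPhysics.QuantumFieldTheory.Balaban1983to89.HaarExponentialChart
open Literature.MathematicalPhysics.QuantumFieldTheory.Balaban1983to89.HaarExponentialChart.IsChartRep
open Literature.MathematicalPhysics.QuantumFieldTheory.Balaban1983to89.BlockAveraging (Small Idx avgFun loopHol)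
open Literature.MathematicalPhysics.QuantumFieldTheory.Balaban1983to89.BlockAveragingHaarAC (centralBond)
open Literature.MathematicalPhysics.QuantumFieldTheory.Balaban1983to89.ExpMeanLog (expMeanLogSU deltaSU)
open Literature.MathematicalPhysics.QuantumFieldTheory.Balaban1983to89.Node00
open Literature.MathematicalPhysics.QuantumFieldTheory.Balaban1983to89.B13HaarSigmaJacobian (jac)
open Summit.QuantumFields.YangMills.BalabanUVNodes.N09ChartReadAveragingSmooth
open Summit.QuantumFields.YangMills.BalabanUVNodes.N09ChartReadAveragingSubmersion
open Summit.QuantumFields.YangMills.BalabanUVNodes.N09OneBondChartRead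

section Law

variable {P : Params} {j : ℕ} {N : ℕ} [NeZero N]
variable (U₀ : GaugeField P j (SU N)) (c : PBond P (j + 1))
variable [MeasurableSpace (specialUnitaryLogChart (Fin N)).lie] [BorelSpace (specialUnitaryLogChart (Fin N)).lie]

/-- ★★★ **THE FORWARD JACOBIAN LAW OF THE ONE-BOND FIBRE MAP, CHART-WINDOW FORM.**  Under the loop α-guard at `U₀`: an open `O ∋ 0` in `𝔰𝔲(N)` inside the chart ball, with `φ = φ_{U₀,c}`
differentiable on `O` (derivative `Dφ`), such that for `Ψ(k) := Ū(U₀[β(c) ↦ k·U₀(β(c))])(c)·Ū(U₀)(c)⁻¹` (the fibre map moved to the identity on both sides):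
`Haar⌊Ψ(Θ(O)) = Ψ_*(J · Haar⌊Θ(O))`, `J(g) = |det jac(φ(Λg))|·|det Dφ(Λg)| ∕ |det jac(Λg)|` — this seat's g4 `haar_restrict_image_eq_map_withDensity_jacobian` fed with the one-bond edition's
window (injectivity, semiconjugacy `Ψ ∘ Θ = Θ ∘ φ`, `φ(O) ⊆ B(0,s_C)`). [cite: Balaban1987RG1, (2.10) p.267; Helgason2000, Ch. I §1 Thm. 1.14 (13) p. 96; Balaban1985UV3, (18) p. 260] -/
theorem exists_forwardLaw_oneBond_at_one (hj : j + 1 ≤ P.m + P.K) (hsmall : ∀ c, Small (expMeanLogSU (n := Fin N)) U₀ c) {α : ℝ}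
    (hα : ∀ i, dist1 (loopHol U₀ c i) ≤ α) (hα24 : α ≤ 1 / 24) (hαδ : α < deltaSU (Fin N)) (hαL : 157 * α < ((P.L : ℝ) ^ (P.d - 1))⁻¹) :
    ∃ O : Set (specialUnitaryLogChart (Fin N)).lie, IsOpen O ∧ (0 : (specialUnitaryLogChart (Fin N)).lie) ∈ O ∧
      O ⊆ Metric.ball (0 : (specialUnitaryLogChart (Fin N)).lie) (chartRadius (specialUnitaryLogChart (Fin N))) ∧
      (∀ X ∈ O, DifferentiableAt ℝ (fun X : (specialUnitaryLogChart (Fin N)).lie =>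
        (isChartRep_specialUnitaryGroup (n := Fin N)).logChart
          (avgFun (expMeanLogSU (n := Fin N)) (fun b => (isChartRep_specialUnitaryGroup (n := Fin N)).expChart
              ((Pi.single (centralBond c) X : PBond P j → (specialUnitaryLogChart (Fin N)).lie) b) * U₀ b) c *
            (avgFun (expMeanLogSU (n := Fin N)) U₀ c)⁻¹)) X) ∧
      Set.InjOn (fun k : SU N => avgFun (expMeanLogSU (n := Fin N)) (Function.update U₀ (centralBond c) (k * U₀ (centralBond c))) c *
          (avgFun (expMeanLogSU (n := Fin N)) U₀ c)⁻¹) ((isChartRep_specialUnitaryGroup (n := Fin N)).expChart '' O) ∧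
      (HaarData.haar : Measure (SU N)).restrict
          ((fun k : SU N => avgFun (expMeanLogSU (n := Fin N)) (Function.update U₀ (centralBond c) (k * U₀ (centralBond c))) c *
            (avgFun (expMeanLogSU (n := Fin N)) U₀ c)⁻¹) '' ((isChartRep_specialUnitaryGroup (n := Fin N)).expChart '' O)) =
        Measure.map (fun k : SU N => avgFun (expMeanLogSU (n := Fin N)) (Function.update U₀ (centralBond c) (k * U₀ (centralBond c))) c *
            (avgFun (expMeanLogSU (n := Fin N)) U₀ c)⁻¹)
          (((HaarData.haar : Measure (SU N)).restrict ((isChartRep_specialUnitaryGroup (n := Fin N)).expChart '' O)).withDensity fun g =>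
            jacDensity (lie_adStable_specialUnitaryGroup (n := Fin N))
                ((fun X : (specialUnitaryLogChart (Fin N)).lie =>
                  (isChartRep_specialUnitaryGroup (n := Fin N)).logChart
                    (avgFun (expMeanLogSU (n := Fin N)) (fun b => (isChartRep_specialUnitaryGroup (n := Fin N)).expChart
                        ((Pi.single (centralBond c) X : PBond P j → (specialUnitaryLogChart (Fin N)).lie) b) * U₀ b) c *
                      (avgFun (expMeanLogSU (n := Fin N)) U₀ c)⁻¹)) ((isChartRep_specialUnitaryGroup (n := Fin N)).logChart g)) *
              ENNReal.ofReal |(fderiv ℝ (fun X : (specialUnitaryLogChart (Fin N)).lie =>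
                  (isChartRep_specialUnitaryGroup (n := Fin N)).logChart
                    (avgFun (expMeanLogSU (n := Fin N)) (fun b => (isChartRep_specialUnitaryGroup (n := Fin N)).expChart
                        ((Pi.single (centralBond c) X : PBond P j → (specialUnitaryLogChart (Fin N)).lie) b) * U₀ b) c *
                      (avgFun (expMeanLogSU (n := Fin N)) U₀ c)⁻¹)) ((isChartRep_specialUnitaryGroup (n := Fin N)).logChart g)).det| /
              jacDensity (lie_adStable_specialUnitaryGroup (n := Fin N)) ((isChartRep_specialUnitaryGroup (n := Fin N)).logChart g)) := by
  set h := isChartRep_specialUnitaryGroup (n := Fin N) with hh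
  set φ := fun X : (specialUnitaryLogChart (Fin N)).lie =>
      h.logChart (avgFun (expMeanLogSU (n := Fin N)) (fun b => h.expChart
          ((Pi.single (centralBond c) X : PBond P j → (specialUnitaryLogChart (Fin N)).lie) b) * U₀ b) c * (avgFun (expMeanLogSU (n := Fin N)) U₀ c)⁻¹) with hφ
  set Ψ := fun k : SU N => avgFun (expMeanLogSU (n := Fin N)) (Function.update U₀ (centralBond c) (k * U₀ (centralBond c))) c *
      (avgFun (expMeanLogSU (n := Fin N)) U₀ c)⁻¹ with hΨ
  haveI := FieldMeasureExpChartChangeOfVariables.isHaarMeasure_haar_specialUnitaryGroup (N := N)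
  -- the one-bond window: injectivity, semiconjugacy, chart ball
  obtain ⟨O₁, hO₁, h0O₁, hO₁ball, hinjφ, hmaps, hsemi, -⟩ :=
    exists_chartWindow_injOn_fibreMap (P := P) (j := j) U₀ c hj hsmall hα hα24 hαδ hαL
  -- the non-degeneracy radius of the chart Jacobian
  obtain ⟨s₀, hs₀, hjac₀⟩ := exists_radius_det_jac_ne_zero (lie_adStable_specialUnitaryGroup (n := Fin N))
  -- differentiability of `φ` on a neighbourhood of `0` (`C^ω` at `0`)
  have hφω : ContDiffAt ℝ ⊤ φ 0 := contDiffAt_oneBond (P := P) (j := j) U₀ c hsmall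
  have hdiffN : ∀ᶠ X in 𝓝 (0 : (specialUnitaryLogChart (Fin N)).lie), DifferentiableAt ℝ φ X := by
    have h1 : ∀ᶠ X in 𝓝 (0 : (specialUnitaryLogChart (Fin N)).lie), ContDiffAt ℝ ⊤ φ X := hφω.eventually (by simp)
    exact h1.mono fun X hX => hX.differentiableAt (by simp)
  have hballN : ∀ᶠ X in 𝓝 (0 : (specialUnitaryLogChart (Fin N)).lie), X ∈ Metric.ball (0 : (specialUnitaryLogChart (Fin N)).lie) s₀ :=
    Metric.isOpen_ball.mem_nhds (Metric.mem_ball_self hs₀)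
  obtain ⟨O₂, hO₂sub, hO₂, h0O₂⟩ := _root_.eventually_nhds_iff.1 (hdiffN.and hballN)
  set O := O₁ ∩ O₂ with hOdef
  have hO : IsOpen O := hO₁.inter hO₂
  have hOm : MeasurableSet O := hO.measurableSet
  have hOball : O ⊆ Metric.ball (0 : (specialUnitaryLogChart (Fin N)).lie) (chartRadius (specialUnitaryLogChart (Fin N))) := fun X hX => hO₁ball hX.1
  have hjac : ∀ X ∈ O, LinearMap.det (jac (lie_adStable_specialUnitaryGroup (n := Fin N)) X :
      (specialUnitaryLogChart (Fin N)).lie →ₗ[ℝ] (specialUnitaryLogChart (Fin N)).lie) ≠ 0 :=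
    hjac₀ O (fun X hX => (hO₂sub X hX.2).2)
  have hψ' : ∀ X ∈ O, HasFDerivWithinAt φ (fderiv ℝ φ X) O X := fun X hX => ((hO₂sub X hX.2).1).hasFDerivAt.hasFDerivWithinAt
  have hΨ : ∀ X ∈ O, Ψ (h.expChart X) = h.expChart (φ X) := by
    intro X hX
    show avgFun (expMeanLogSU (n := Fin N)) (Function.update U₀ (centralBond c) (h.expChart X * U₀ (centralBond c))) c *
        (avgFun (expMeanLogSU (n := Fin N)) U₀ c)⁻¹ = h.expChart (φ X)
    rw [hsemi X hX.1, mul_inv_cancel_right]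
  refine ⟨O, hO, ⟨h0O₁, h0O₂⟩, hOball, fun X hX => (hO₂sub X hX.2).1, ?_, ?_⟩
  · -- injectivity of `Ψ` on `Θ(O)` from that of the fibre map
    rintro _ ⟨X, hX, rfl⟩ _ ⟨X', hX', rfl⟩ hXX'
    have hinjF := (exists_chartWindow_injOn_fibreMap (P := P) (j := j) U₀ c hj hsmall hα hα24 hαδ hαL)
    -- use the semiconjugacy: `Θ(φ X) = Θ(φ X')` ⇒ `φ X = φ X'` ⇒ `X = X'`
    have e : h.expChart (φ X) = h.expChart (φ X') := by rw [← hΨ X hX, ← hΨ X' hX']; exact hXX'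
    have hφeq : φ X = φ X' := (h.injOn_expChart le_rfl) (hmaps hX.1) (hmaps hX'.1) e
    rw [hinjφ hX.1 hX'.1 hφeq]
  · exact h.haar_restrict_image_eq_map_withDensity_jacobian (lie_adStable_specialUnitaryGroup (n := Fin N))
      (HaarData.haar : Measure (SU N)) chartRadius_pos le_rfl hOm hOball hjac hψ' (hinjφ.mono Set.inter_subset_left)
      (fun X hX => hmaps hX.1) hΨ

omit [NeZero N] [MeasurableSpace (specialUnitaryLogChart (Fin N)).lie] [BorelSpace (specialUnitaryLogChart (Fin N)).lie] in
/-- Bookkeeping: a right translation carries a restricted right-invariant measure onto the restriction to the translated set. [cite: Balaban1985Averaging, (10) p.19 (bookkeeping)] -/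
theorem restrict_image_mulRight_eq_map (μ : Measure (SU N)) [μ.IsMulRightInvariant] (u : SU N) (S : Set (SU N)) :
    μ.restrict ((fun k : SU N => k * u) '' S) = Measure.map (fun k : SU N => k * u) (μ.restrict S) := by
  have he : ((fun k : SU N => k * u)) = (MeasurableEquiv.mulRight u : SU N → SU N) := rfl
  have hpre : (fun k : SU N => k * u) ⁻¹' ((fun k : SU N => k * u) '' S) = S :=
    (MeasurableEquiv.mulRight u).injective.preimage_image S
  conv_lhs => rw [← map_mul_right_eq_self μ u]
  rw [he, (MeasurableEquiv.mulRight u).measurableEmbedding.restrict_map, ← he, hpre]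

/-- ★★★ **THE FORWARD JACOBIAN LAW OF THE ONE-BOND FIBRE MAP ON A WINDOW AROUND `U₀(β(c))`** — the `hlaw`-shape input of dag-n09-w6's private-coordinate road, at the tree's Haar data:
under the loop α-guard at `U₀` there is an open chart set `O ∋ 0` such that, with the window `W := Θ(O)·U₀(β(c))` and the fibre map `F(g) := Ū(U₀[β(c) ↦ g])(c)`, `F` is INJECTIVE on `W` and
`Haar⌊F(W) = F_*(J_F · Haar⌊W)`, `J_F(g) = J(g·U₀(β(c))⁻¹)` with `J` the chart-window Jacobian of `exists_forwardLaw_oneBond_at_one` (right translations on both sides preserve Haar).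
[cite: Balaban1987RG1, (2.10) p.267; Balaban1985Averaging, (10) p.19; Helgason2000, Ch. I §1 Thm. 1.14 (13) p. 96] -/
theorem exists_forwardLaw_oneBond (hj : j + 1 ≤ P.m + P.K) (hsmall : ∀ c, Small (expMeanLogSU (n := Fin N)) U₀ c) {α : ℝ}
    (hα : ∀ i, dist1 (loopHol U₀ c i) ≤ α) (hα24 : α ≤ 1 / 24) (hαδ : α < deltaSU (Fin N)) (hαL : 157 * α < ((P.L : ℝ) ^ (P.d - 1))⁻¹) :
    ∃ (O : Set (specialUnitaryLogChart (Fin N)).lie) (J : SU N → ℝ≥0∞), IsOpen O ∧ (0 : (specialUnitaryLogChart (Fin N)).lie) ∈ O ∧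
      O ⊆ Metric.ball (0 : (specialUnitaryLogChart (Fin N)).lie) (chartRadius (specialUnitaryLogChart (Fin N))) ∧
      U₀ (centralBond c) ∈ (fun X => (isChartRep_specialUnitaryGroup (n := Fin N)).expChart X * U₀ (centralBond c)) '' O ∧
      Set.InjOn (fun g : SU N => avgFun (expMeanLogSU (n := Fin N)) (Function.update U₀ (centralBond c) g) c)
        ((fun X => (isChartRep_specialUnitaryGroup (n := Fin N)).expChart X * U₀ (centralBond c)) '' O) ∧
      (HaarData.haar : Measure (SU N)).restrict
          ((fun g : SU N => avgFun (expMeanLogSU (n := Fin N)) (Function.update U₀ (centralBond c) g) c) ''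
            ((fun X => (isChartRep_specialUnitaryGroup (n := Fin N)).expChart X * U₀ (centralBond c)) '' O)) =
        Measure.map (fun g : SU N => avgFun (expMeanLogSU (n := Fin N)) (Function.update U₀ (centralBond c) g) c)
          (((HaarData.haar : Measure (SU N)).restrict
              ((fun X => (isChartRep_specialUnitaryGroup (n := Fin N)).expChart X * U₀ (centralBond c)) '' O)).withDensity
            fun g => J (g * (U₀ (centralBond c))⁻¹)) := by
  set h := isChartRep_specialUnitaryGroup (n := Fin N) with hh
  set u : SU N := U₀ (centralBond c) with hu
  set a : SU N := avgFun (expMeanLogSU (n := Fin N)) U₀ c with ha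
  set F := fun g : SU N => avgFun (expMeanLogSU (n := Fin N)) (Function.update U₀ (centralBond c) g) c with hF
  haveI := FieldMeasureExpChartChangeOfVariables.isHaarMeasure_haar_specialUnitaryGroup (N := N)
  haveI : (HaarData.haar : Measure (SU N)).IsMulRightInvariant := FieldMeasureExpChartChangeOfVariables.isMulRightInvariant_haar
  obtain ⟨O, hO, h0O, hOball, -, hinjΨ, hlaw⟩ := exists_forwardLaw_oneBond_at_one (P := P) (j := j) U₀ c hj hsmall hα hα24 hαδ hαL
  -- the window Jacobian at the identity (as in the previous theorem)
  set J : SU N → ℝ≥0∞ := fun g =>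
    jacDensity (lie_adStable_specialUnitaryGroup (n := Fin N))
        ((fun X : (specialUnitaryLogChart (Fin N)).lie =>
          h.logChart (avgFun (expMeanLogSU (n := Fin N)) (fun b => h.expChart
              ((Pi.single (centralBond c) X : PBond P j → (specialUnitaryLogChart (Fin N)).lie) b) * U₀ b) c *
            (avgFun (expMeanLogSU (n := Fin N)) U₀ c)⁻¹)) (h.logChart g)) *
      ENNReal.ofReal |(fderiv ℝ (fun X : (specialUnitaryLogChart (Fin N)).lie =>
          h.logChart (avgFun (expMeanLogSU (n := Fin N)) (fun b => h.expChart
              ((Pi.single (centralBond c) X : PBond P j → (specialUnitaryLogChart (Fin N)).lie) b) * U₀ b) c *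
            (avgFun (expMeanLogSU (n := Fin N)) U₀ c)⁻¹)) (h.logChart g)).det| /
      jacDensity (lie_adStable_specialUnitaryGroup (n := Fin N)) (h.logChart g) with hJ
  set Ψ := fun k : SU N => avgFun (expMeanLogSU (n := Fin N)) (Function.update U₀ (centralBond c) (k * U₀ (centralBond c))) c *
      (avgFun (expMeanLogSU (n := Fin N)) U₀ c)⁻¹ with hΨ
  have hFΨ : ∀ g : SU N, F g = Ψ (g * u⁻¹) * a := by
    intro g
    show avgFun (expMeanLogSU (n := Fin N)) (Function.update U₀ (centralBond c) g) c =
      avgFun (expMeanLogSU (n := Fin N)) (Function.update U₀ (centralBond c) (g * u⁻¹ * U₀ (centralBond c))) c *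
        (avgFun (expMeanLogSU (n := Fin N)) U₀ c)⁻¹ * avgFun (expMeanLogSU (n := Fin N)) U₀ c
    rw [hu, inv_mul_cancel_right, inv_mul_cancel_right]
  refine ⟨O, J, hO, h0O, hOball, ⟨0, h0O, by simp only [h.expChart_zero, one_mul]⟩, ?_, ?_⟩
  · -- injectivity of `F` on the translated window from that of `Ψ` on `Θ(O)`
    rintro _ ⟨X, hX, rfl⟩ _ ⟨X', hX', rfl⟩ hXX'
    have e : Ψ (h.expChart X) = Ψ (h.expChart X') := by
      have e1 := hFΨ (h.expChart X * u)
      have e2 := hFΨ (h.expChart X' * u)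
      rw [mul_inv_cancel_right] at e1 e2
      have : F (h.expChart X * u) = F (h.expChart X' * u) := hXX'
      rw [e1, e2] at this
      exact mul_right_cancel this
    show h.expChart X * u = h.expChart X' * u
    rw [hinjΨ ⟨X, hX, rfl⟩ ⟨X', hX', rfl⟩ e]
  · -- transport the law at the identity by the two right translations
    have hW : (fun X => h.expChart X * U₀ (centralBond c)) '' O = (fun k : SU N => k * u) '' (h.expChart '' O) := by
      rw [Set.image_image]
    have hFW : F '' ((fun X => h.expChart X * U₀ (centralBond c)) '' O) = (fun k : SU N => k * a) '' (Ψ '' (h.expChart '' O)) := by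
      rw [Set.image_image, Set.image_image, Set.image_image]
      refine Set.image_congr' fun X => ?_
      show F (h.expChart X * u) = Ψ (h.expChart X) * a
      rw [hFΨ, mul_inv_cancel_right]
    have hFm : Measurable F := by
      have hupd : Measurable fun g : SU N => Function.update U₀ (centralBond c) g := measurable_update' .. |>.comp (measurable_const.prodMk measurable_id)
      exact (measurable_pi_apply c).comp ((BlockAveraging.measurable_avgFun _ ExpMeanLog.measurable_expMeanLogSU_E).comp hupd)
    have hΨm : Measurable Ψ := by
      have : Ψ = fun k : SU N => F (k * u) * a⁻¹ := rfl
      rw [this]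
      exact (hFm.comp (measurable_mul_const u)).mul_const _
    rw [hFW, restrict_image_mulRight_eq_map (HaarData.haar : Measure (SU N)) a, hlaw, Measure.map_map (measurable_mul_const a) hΨm,
      hW, restrict_image_mulRight_eq_map (HaarData.haar : Measure (SU N)) u]
    -- move the density across the right translation by `u` and compose the maps
    have hdens : (Measure.map (fun k : SU N => k * u) ((HaarData.haar : Measure (SU N)).restrict (h.expChart '' O))).withDensity
        (fun g => J (g * (U₀ (centralBond c))⁻¹)) =
        Measure.map (fun k : SU N => k * u) (((HaarData.haar : Measure (SU N)).restrict (h.expChart '' O)).withDensity J) := by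
      have he : ((fun k : SU N => k * u)) = (MeasurableEquiv.mulRight u : SU N → SU N) := rfl
      rw [he, map_withDensity_measurableEquiv]
      rfl
    rw [hdens, Measure.map_map hFm (measurable_mul_const u)]
    congr 1
    funext k
    show Ψ k * a = F (k * u)
    rw [hFΨ, mul_inv_cancel_right]

end Law

end Summit.QuantumFields.YangMills.BalabanUVNodes.N09OneBondForwardLaw
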